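import Summits.KontsevichZagierPeriods.KontsevichZagierPeriods.Theorems.RootDecompRationalCubeDichotomyRankDescentP21

/-! # `RootDecompRationalCubeDichotomyRankDescentP22` — part 8/9 of the mechanical ≤400-line split of `RankDescent_delta_v12_to_v14h_P15plus.lean` (sha256 311877f354eea7b0…)
Source: decomp-kz lens-2 g15 RankDescent_delta_v12_to_v14h_P15plus.lean @311877f3 (critic CLEARED g7-6 l.1400: 26322 ⟺ LetterDegenerateKernel, GenericKernel THEOREM); --supports stmt-KontsevichZagierPeriods-26322.
Split by census-1 g10 `gen/splitlean.py`: scopes re-opened with their `open`/`variable`/`set_option` context; mathematics and declaration order unchanged. -/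

noncomputable section
open MeasureTheory Set MvPolynomial
open Literature.NumberTheory.Transcendental
open Literature.NumberTheory.Transcendental.KZ
namespace Summit.KontsevichZagierPeriods.RootDecompRationalCubeDichotomy.Rung26322.RankDescent
variable {M : ℕ}
section LetterCriterion
variable {k : ℕ}
section SubstitutionMove
section LandenDecided
variable (q : ℚ) (hq1 : 1 < q)

/-- **THE LANDEN RESIDENT IS DECIDED INSIDE THE CALCULUS: `[P_L/Q_L] ∈ relations`** (`s = 1`).
(cite KontsevichZagier2001, §1.2) -/
theorem landenR_mem_relations : KZ.of (landenR q hq1).rep ∈ KZ.relations := by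
  have h1 : KZ.of (landenR q hq1).rep - KZ.of (smulNum 1 (landenR q hq1)).rep ∈ KZ.relations :=
    RFun.rel_of_eqOn fun x _ => by rw [fn_smulNum, Rat.cast_one, one_mul]
  have e : KZ.of (landenR q hq1).rep = (KZ.of (landenR q hq1).rep - KZ.of (smulNum 1 (landenR q hq1)).rep)
      + KZ.of (smulNum 1 (landenR q hq1)).rep := by abel
  rw [e]
  exact add_mem h1 (smul_landenR_mem_relations q hq1 1)

/-- **26322 HOLDS AT THE CERTIFIED SPECIAL RESIDENT** (`N = 0`, no input): every representation with the data
of 26322 for `(P_L, Q_L)` — cube domain, integrand `P_L/Q_L` pointwise (its value is `0`) — is a relation.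
The first value-`0` instance outside THEOREM U's reach is decided by the one move THEOREM U does not use.
(cite KontsevichZagier2001, §1.2) -/
theorem landen_single (hq1 : 1 < q) (q' : IntegralRep 2)
    (hd : q'.domain = Set.pi Set.univ (fun _ : Fin 2 => Set.Icc (0:ℝ) 1))
    (hf : ∀ z ∈ Set.pi Set.univ (fun _ : Fin 2 => Set.Icc (0:ℝ) 1),
      q'.integrand z = MvPolynomial.aeval z (landenP q) / MvPolynomial.aeval z (landenQ q)) :
    ∃ N : ℕ, (fun y : FormalRep => of piRep * y)^[N] (of q') ∈ relations := by
  refine ⟨0, ?_⟩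
  have hQ : ∀ z ∈ Set.pi Set.univ (fun _ : Fin 2 => Set.Icc (0:ℝ) 1), MvPolynomial.aeval z (landenQ q) ≠ 0 :=
    fun z hz => landenQ_ne_zero q hq1 z (by rw [KZ.cube_eq_pi]; exact hz)
  have h1 := of_sub_cubeRFun_mem q' (landenP q) (landenQ q) hd hQ hf
  have h2 : KZ.of (cubeRFun (landenP q) (landenQ q) hQ).rep - KZ.of (landenR q hq1).rep ∈ KZ.relations :=
    RFun.rel_of_eqOn fun x _ => rfl
  have h3 := landenR_mem_relations q hq1
  have e : of q' = (of q' - of (cubeRFun (landenP q) (landenQ q) hQ).rep)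
      + (of (cubeRFun (landenP q) (landenQ q) hQ).rep - of (landenR q hq1).rep) + of (landenR q hq1).rep := by abel
  rw [Function.iterate_zero, id, e]
  exact add_mem (add_mem h1 h2) h3

end LandenDecided

end SubstitutionMove

section LandenClass

/-! ### §18d — THE LANDEN CLASS DECIDED: every numerator over `Q_L`, modulo the two-point input at level 1

Over `Q_L = F₁F₂F₃` (`F₁ = q + u`, `F₂ = −q + u`, `F₃ = −q² + u`, `u = x₀⋯x_{k−1}`): SPAN by three letters
`1/F_r` (Bezout `F₁F₂ − (u + q²)F₃ = q⁴ − q²`, `span_two`, §9), values in the three towers' spans, the level-1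
letter relation `L_1(−q²) = L_1(q) + L_1(−q)` (logs) and the level-2 Landen relation `L_2(−q²) = 2L_2(q) +
2L_2(−q)` REALISED by the substitution move (`smul_landenR_mem_relations`): every value-`0` `[P/Q_L]` on the
square is a relation, GIVEN only that `L_2(q), L_2(−q)` are jointly new over the lower values — the SAME input
`TwoPointNew q (−q) · · 1` as Instance 2 (DHK 2020, Cor. 1). The special resident's whole class is decided with
letters-modulo-(Ex0m + ONE substitution relation): the prototype of the g16 criterion. -/

variable (q : ℚ) (hq1 : 1 < q)

/-- Bezout for the Landen triple: `F₁F₂ − (u + q²)·F₃ = q⁴ − q²`. [folklore] -/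
theorem landen_bezout (k : ℕ) :
    fhQ k q * fhQ k (-q) - ((∏ i, X i) + C (q ^ 2)) * fhQ k (-q ^ 2)
      = (C (q ^ 4 - q ^ 2) : MvPolynomial (Fin k) ℚ) := by
  simp only [fhQ_eq, map_neg, map_pow, map_sub]
  ring

include hq1 in
/-- Auxiliary step `landen_kappa_ne_zero` (§18d): landen kappa ne zero. [bookkeeping] -/
theorem landen_kappa_ne_zero : q ^ 4 - q ^ 2 ≠ 0 := by
  have h0 : 0 < q := zero_lt_one.trans hq1
  have h : q ^ 4 - q ^ 2 = q ^ 2 * (q - 1) * (q + 1) := by ring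
  rw [h]
  exact mul_ne_zero (mul_ne_zero (by positivity) (sub_ne_zero.2 hq1.ne')) (by linarith : (0:ℚ) < q + 1).ne'

include hq1 in
/-- Auxiliary step `q_ne_neg_q` (§18d): q ne neg q. [bookkeeping] -/
theorem q_ne_neg_q : q ≠ -q := by
  intro h
  linarith

include hq1 in
/-- **SPAN over `Q_L`**: every numerator is, modulo `Ex0m Q_L`, a rational combination of `N₁ = F₂F₃`,
`N₂ = F₁F₃`, `N₃ = F₁F₂` (Bezout between `F₁F₂` and `F₃`, then `span_two` and §9, glued by `mul_mem_ex0m_mul`).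
[folklore] -/
theorem span_landen {k : ℕ} (P : MvPolynomial (Fin (k + 1)) ℚ) :
    ∃ a b c : ℚ, P - (C a * (fhQ (k + 1) (-q) * fhQ (k + 1) (-q ^ 2))
        + C b * (fhQ (k + 1) q * fhQ (k + 1) (-q ^ 2)) + C c * (fhQ (k + 1) q * fhQ (k + 1) (-q)))
      ∈ Ex0m (fhQ (k + 1) q * (fhQ (k + 1) (-q) * fhQ (k + 1) (-q ^ 2))) := by
  have hκ0 : q ^ 4 - q ^ 2 ≠ 0 := landen_kappa_ne_zero q hq1
  have hbez := landen_bezout q (k + 1)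
  -- (i) tower span over F₃, multiplied by F₁F₂
  have e₁ : (P - C (diagAltm (-q ^ 2) P)) * (fhQ (k + 1) q * fhQ (k + 1) (-q))
      ∈ Ex0m (fhQ (k + 1) q * (fhQ (k + 1) (-q) * fhQ (k + 1) (-q ^ 2))) := by
    have h := mul_mem_ex0m_mul (fhQ (k + 1) q * fhQ (k + 1) (-q)) (sub_C_diagAltm_mem (-q ^ 2) P)
    have hQ : fhQ (k + 1) (-q ^ 2) * (fhQ (k + 1) q * fhQ (k + 1) (-q))
        = fhQ (k + 1) q * (fhQ (k + 1) (-q) * fhQ (k + 1) (-q ^ 2)) := by ring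
    rwa [hQ] at h
  -- (ii) two-point span of `P·(u + q²)` over F₁F₂, multiplied by F₃
  have e₂ : (P * ((∏ i, X i) + C (q ^ 2))
        - (C ((-q - q)⁻¹ * diagAltm q (P * ((∏ i, X i) + C (q ^ 2)))) * fhQ (k + 1) (-q)
          + C (-((-q - q)⁻¹ * diagAltm (-q) (P * ((∏ i, X i) + C (q ^ 2))))) * fhQ (k + 1) q))
        * fhQ (k + 1) (-q ^ 2)
      ∈ Ex0m (fhQ (k + 1) q * (fhQ (k + 1) (-q) * fhQ (k + 1) (-q ^ 2))) := by
    have h := mul_mem_ex0m_mul (fhQ (k + 1) (-q ^ 2))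
      (span_two q (-q) (q_ne_neg_q q hq1) (P * ((∏ i, X i) + C (q ^ 2))))
    have hQ : fhQ (k + 1) q * fhQ (k + 1) (-q) * fhQ (k + 1) (-q ^ 2)
        = fhQ (k + 1) q * (fhQ (k + 1) (-q) * fhQ (k + 1) (-q ^ 2)) := by ring
    rwa [hQ] at h
  have e := Submodule.smul_mem _ (q ^ 4 - q ^ 2)⁻¹ (Submodule.sub_mem _ e₁ e₂)
  rw [MvPolynomial.smul_eq_C_mul] at e
  refine ⟨-((q ^ 4 - q ^ 2)⁻¹ * ((-q - q)⁻¹ * diagAltm q (P * ((∏ i, X i) + C (q ^ 2))))),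
    -((q ^ 4 - q ^ 2)⁻¹ * -((-q - q)⁻¹ * diagAltm (-q) (P * ((∏ i, X i) + C (q ^ 2))))),
    (q ^ 4 - q ^ 2)⁻¹ * diagAltm (-q ^ 2) P, ?_⟩
  have hu : C (q ^ 4 - q ^ 2)⁻¹ * C (q ^ 4 - q ^ 2) = (1 : MvPolynomial (Fin (k + 1)) ℚ) := by
    rw [← map_mul, inv_mul_cancel₀ hκ0, map_one]
  convert e using 1
  calc P - (C (-((q ^ 4 - q ^ 2)⁻¹ * ((-q - q)⁻¹ * diagAltm q (P * ((∏ i, X i) + C (q ^ 2))))))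
          * (fhQ (k + 1) (-q) * fhQ (k + 1) (-q ^ 2))
        + C (-((q ^ 4 - q ^ 2)⁻¹ * -((-q - q)⁻¹ * diagAltm (-q) (P * ((∏ i, X i) + C (q ^ 2))))))
          * (fhQ (k + 1) q * fhQ (k + 1) (-q ^ 2))
        + C ((q ^ 4 - q ^ 2)⁻¹ * diagAltm (-q ^ 2) P) * (fhQ (k + 1) q * fhQ (k + 1) (-q)))
      = C (q ^ 4 - q ^ 2)⁻¹ * C (q ^ 4 - q ^ 2) * P
        - (C (-((q ^ 4 - q ^ 2)⁻¹ * ((-q - q)⁻¹ * diagAltm q (P * ((∏ i, X i) + C (q ^ 2))))))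
          * (fhQ (k + 1) (-q) * fhQ (k + 1) (-q ^ 2))
        + C (-((q ^ 4 - q ^ 2)⁻¹ * -((-q - q)⁻¹ * diagAltm (-q) (P * ((∏ i, X i) + C (q ^ 2))))))
          * (fhQ (k + 1) q * fhQ (k + 1) (-q ^ 2))
        + C ((q ^ 4 - q ^ 2)⁻¹ * diagAltm (-q ^ 2) P) * (fhQ (k + 1) q * fhQ (k + 1) (-q))) := by
          rw [hu, one_mul]
    _ = C (q ^ 4 - q ^ 2)⁻¹ * (P * (fhQ (k + 1) q * fhQ (k + 1) (-q) - ((∏ i, X i) + C (q ^ 2)) * fhQ (k + 1) (-q ^ 2)))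
        - (C (-((q ^ 4 - q ^ 2)⁻¹ * ((-q - q)⁻¹ * diagAltm q (P * ((∏ i, X i) + C (q ^ 2))))))
          * (fhQ (k + 1) (-q) * fhQ (k + 1) (-q ^ 2))
        + C (-((q ^ 4 - q ^ 2)⁻¹ * -((-q - q)⁻¹ * diagAltm (-q) (P * ((∏ i, X i) + C (q ^ 2))))))
          * (fhQ (k + 1) q * fhQ (k + 1) (-q ^ 2))
        + C ((q ^ 4 - q ^ 2)⁻¹ * diagAltm (-q ^ 2) P) * (fhQ (k + 1) q * fhQ (k + 1) (-q))) := by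
          rw [hbez]; ring
    _ = _ := by
          simp only [map_neg, map_mul]
          ring

/-- `[ [0,1]^k, P/Q_L ]`, `Q_L = F₁(F₂F₃)`. (folklore) -/
def landenT (k : ℕ) (P : MvPolynomial (Fin k) ℚ) : RFun k :=
  ⟨P, fhQ k q * (fhQ k (-q) * fhQ k (-q ^ 2)), fun x hx => by
    rw [map_mul, map_mul]
    exact mul_ne_zero (fhQ_ne_zero_of q (landen_h₁ q hq1) x hx)
      (mul_ne_zero (fhQ_ne_zero_of (-q) (landen_h₂ q hq1) x hx)
        (fhQ_ne_zero_of (-q ^ 2) (landen_h₃ q hq1) x hx))⟩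

/-- **Values over `Q_L` lie in the three towers' spans**: `∫ P/Q_L = κ⁻¹∫P/F₃ − κ⁻¹∫P(u+q²)/(F₁F₂)`
(Bezout; then `value_twoR`, THEOREM A). [folklore] -/
theorem value_landenT_mem (k : ℕ) (P : MvPolynomial (Fin k) ℚ) :
    (landenT q hq1 k P).rep.value ∈ inSpanSub q (landen_h₁ q hq1) k ⊔ inSpanSub (-q) (landen_h₂ q hq1) k
        ⊔ inSpanSub (-q ^ 2) (landen_h₃ q hq1) k := by
  have hκ0 := landen_kappa_ne_zero q hq1
  have hv : (landenT q hq1 k P).rep.value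
      = ((smulNum (q ^ 4 - q ^ 2)⁻¹ (fhR (-q ^ 2) (landen_h₃ q hq1) k P)).add
          (smulNum (-(q ^ 4 - q ^ 2)⁻¹) (twoR q (-q) (landen_h₁ q hq1) (landen_h₂ q hq1) k
            (P * ((∏ i, X i) + C (q ^ 2)))))).rep.value := by
    refine value_eq_of_fn_eq fun x hx => ?_
    have n₁ := fhQ_ne_zero_of q (landen_h₁ q hq1) x hx
    have n₂ := fhQ_ne_zero_of (-q) (landen_h₂ q hq1) x hx
    have n₃ := fhQ_ne_zero_of (-q ^ 2) (landen_h₃ q hq1) x hx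
    have hq1' : (1 : ℝ) < q := by exact_mod_cast hq1
    have hκ₁ : (-1 + (q : ℝ) ^ 2) ≠ 0 := by nlinarith
    have hκ₂ : ((q : ℝ) ^ 2 - 1) ≠ 0 := by nlinarith
    have hκ₃ : (q : ℝ) ≠ 0 := by positivity
    have hκ : ((q ^ 4 - q ^ 2 : ℚ) : ℝ) ≠ 0 := by exact_mod_cast hκ0
    rw [RFun.fn_add hx, fn_smulNum, fn_smulNum]
    simp only [RFun.fn_apply, landenT, twoR, fhR_num, fhR_den, map_mul, map_add, map_prod, aeval_fhQ,
      MvPolynomial.aeval_C, MvPolynomial.aeval_X, eq_ratCast] at n₁ n₂ n₃ ⊢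
    push_cast at n₁ n₂ n₃ hκ ⊢
    field_simp
    ring
  rw [hv, value_add, value_smulNum, value_smulNum, value_twoR q (-q) _ _ (q_ne_neg_q q hq1)]
  refine add_mem (Submodule.mem_sup_right ?_) (Submodule.mem_sup_left ?_)
  · exact InSpan.smul _ _ _ (fhV_inSpan _ _ k P)
  · rw [mul_add, ← mul_assoc, ← mul_assoc, ← Rat.cast_mul, ← Rat.cast_mul]
    exact add_mem (Submodule.mem_sup_left (InSpan.smul _ _ _ (fhV_inSpan _ _ k _)))
      (Submodule.mem_sup_right (InSpan.smul _ _ _ (fhV_inSpan _ _ k _)))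

/-- **The level-1 letter relation** `L_1(−q²) = L_1(q) + L_1(−q)`
(`log((q²−1)/q²) = log((q+1)/q) + log((q−1)/q)`). [folklore] -/
theorem letter_one_landen :
    letter (-q ^ 2) (landen_h₃ q hq1) 1 = letter q (landen_h₁ q hq1) 1 + letter (-q) (landen_h₂ q hq1) 1 := by
  have hq0 : (0 : ℝ) < q := by exact_mod_cast zero_lt_one.trans hq1
  have hq1' : (1 : ℝ) < q := by exact_mod_cast hq1
  have hqne : (q : ℝ) ≠ 0 := hq0.ne'
  rw [letter_one, letter_one, letter_one]
  push_cast
  rw [← Real.log_mul]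
  · congr 1
    field_simp
    ring
  · exact div_ne_zero (by linarith : (0:ℝ) < q + 1).ne' hqne
  · exact div_ne_zero (by linarith : -(q:ℝ) + 1 < 0).ne (by linarith : -(q:ℝ) < 0).ne

/-- Hence the third tower's level-1 span folds into the first two. [folklore] -/
theorem inSpanSub_negSq_le :
    inSpanSub (-q ^ 2) (landen_h₃ q hq1) 1
      ≤ inSpanSub q (landen_h₁ q hq1) 1 ⊔ inSpanSub (-q) (landen_h₂ q hq1) 1 := by
  rintro v ⟨c₀, c, rfl⟩
  simp only [Finset.univ_unique, Fin.default_eq_zero, Finset.sum_singleton, Fin.isValue, Fin.val_zero,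
    zero_add]
  rw [letter_one_landen q hq1, mul_add, ← add_assoc]
  refine add_mem (Submodule.mem_sup_left ?_) (Submodule.mem_sup_right ?_)
  · exact ⟨c₀, fun _ => c 0, by simp⟩
  · exact ⟨0, fun _ => c 0, by simp⟩

/-- **Every face value of `Q_L` on the square lies in `W = ℚ + ℚL_1(q) + ℚL_1(−q)`**: the face `x_j = 0`
has the constant denominator `q·(−q)·(−q²)` (rational value); the face `x_j = 1` is `[P/(F₁F₂F₃)]` on
`[0,1]` (three towers' level-1 spans, the third folded by `letter_one_landen`). [folklore] -/
theorem face_value_mem (S : RFun 1) (j : Fin 2) (c : ℚ) (hc : c = 0 ∨ c = 1)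
    (hS : S.den = bind₁ (insX j c) (fhQ 2 q * (fhQ 2 (-q) * fhQ 2 (-q ^ 2)))) :
    S.rep.value ∈ inSpanSub q (landen_h₁ q hq1) 1 ⊔ inSpanSub (-q) (landen_h₂ q hq1) 1 := by
  have hq0 : 0 < q := zero_lt_one.trans hq1
  rcases hc with rfl | rfl
  · have hu : (q * (-q) * (-q ^ 2) : ℚ) ≠ 0 := by
      have : q ≠ 0 := hq0.ne'
      simp [this]
    have hz : ∀ x ∈ KZ.cube 1, aeval x (C (q * (-q) * (-q ^ 2)) : MvPolynomial (Fin 1) ℚ) ≠ 0 :=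
      fun x _ => by rw [MvPolynomial.aeval_C, eq_ratCast]; exact_mod_cast hu
    have hv : S.rep.value = (⟨S.num, C (q * (-q) * (-q ^ 2)), hz⟩ : RFun 1).rep.value := by
      refine value_eq_of_fn_eq fun x hx => ?_
      rw [RFun.fn_apply, RFun.fn_apply, hS]
      simp only [map_mul, aeval_bind₁_insX, aeval_fhQ_insertNth, MvPolynomial.aeval_C, eq_ratCast]
      push_cast
      ring
    obtain ⟨r, hr⟩ := exists_rat_value_of_den_C (⟨S.num, C (q * (-q) * (-q ^ 2)), hz⟩ : RFun 1) rfl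
    rw [hv, hr]
    exact Submodule.mem_sup_left (inSpan_rat q _ r)
  · have hv : S.rep.value = (landenT q hq1 1 S.num).rep.value := by
      refine value_eq_of_fn_eq fun x hx => ?_
      rw [RFun.fn_apply, RFun.fn_apply, hS]
      simp only [landenT, map_mul, aeval_bind₁_insX, aeval_fhQ_insertNth]
      simp only [aeval_fhQ]
      push_cast
      ring
    rw [hv]
    exact sup_le le_rfl (inSpanSub_negSq_le q hq1) (value_landenT_mem q hq1 1 S.num)

/-- The letter combination `M(a,b,c) = a·N₁ + b·N₂ + c·N₃` over `Q_L`. (folklore) -/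
def landenM (a b c : ℚ) : MvPolynomial (Fin 2) ℚ :=
  C a * (fhQ 2 (-q) * fhQ 2 (-q ^ 2)) + C b * (fhQ 2 q * fhQ 2 (-q ^ 2)) + C c * (fhQ 2 q * fhQ 2 (-q))

/-- **THE LANDEN CLASS IS DECIDED (modulo the two-point input at level 1).** For every numerator `P` on
the square with `∫∫ P/Q_L = 0`: `[P/Q_L] ∈ relations`. Proof = THEOREM U's step with ONE twist: SPAN
`P ≡ aN₁ + bN₂ + cN₃ (mod Ex0m Q_L)` (`span_landen`); the exact part descends to its faces, whose values lie
in `W = ℚ + ℚL_1(q) + ℚL_1(−q)` (`face_value_mem`); on values, Landen `L_2(−q²) = 2L_2(q) + 2L_2(−q)` turns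
`0 = v_E + aL_2(q) + bL_2(−q) + cL_2(−q²)` into `(a+2c)L_2(q) + (b+2c)L_2(−q) ∈ W`, so `a + 2c = b + 2c = 0`
by `TwoPointNew q (−q) 1`; then the letter part IS `−2c·[P_L/Q_L]`, a relation by the substitution move
(`smul_landenR_mem_relations`), and the face family has total value `0`, a relation by Baker-in-the-tree.
(cite KontsevichZagier2001, §1.2; arXiv:2010.09167, Corollary 1) -/
theorem landen_class_decided (hN : TwoPointNew q (-q) (landen_h₁ q hq1) (landen_h₂ q hq1) 1)
    (P : MvPolynomial (Fin 2) ℚ) (h0 : (landenT q hq1 2 P).rep.value = 0) :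
    KZ.of (landenT q hq1 2 P).rep ∈ KZ.relations := by
  classical
  obtain ⟨a, b, c, hspan⟩ := span_landen q hq1 P
  set E : RFun 2 := landenT q hq1 2 (P - landenM q a b c) with hE
  set L : RFun 2 := landenT q hq1 2 (landenM q a b c) with hL
  -- (1) the formal split T ≐ E + L
  have hpt : ∀ x ∈ KZ.cube 2, (landenT q hq1 2 P).fn x = (E.add L).fn x := fun x hx => by
    rw [RFun.fn_add hx]
    simp only [hE, hL, RFun.fn_apply, landenT, map_sub]
    ring
  have h1 : KZ.of (landenT q hq1 2 P).rep - KZ.of E.rep - KZ.of L.rep ∈ KZ.relations := by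
    have e1 := RFun.rel_of_eqOn hpt
    have e2 := RFun.rel_add E L
    have e : KZ.of (landenT q hq1 2 P).rep - KZ.of E.rep - KZ.of L.rep
        = (KZ.of (landenT q hq1 2 P).rep - KZ.of (E.add L).rep)
          + (KZ.of (E.add L).rep - KZ.of E.rep - KZ.of L.rep) := by abel
    rw [e]
    exact add_mem e1 e2
  have hTval : (landenT q hq1 2 P).rep.value = E.rep.value + L.rep.value := by
    rw [value_eq_of_fn_eq hpt, value_add]
  -- (2) the value of the letter part
  have hLv : L.rep.value = (a : ℝ) * letter q (landen_h₁ q hq1) 2 + (b : ℝ) * letter (-q) (landen_h₂ q hq1) 2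
      + (c : ℝ) * letter (-q ^ 2) (landen_h₃ q hq1) 2 := by
    set t : Fin 3 → RFun 2 := ![smulNum a (fhR q (landen_h₁ q hq1) 2 1),
      smulNum b (fhR (-q) (landen_h₂ q hq1) 2 1), smulNum c (fhR (-q ^ 2) (landen_h₃ q hq1) 2 1)] with ht
    have hrel : KZ.of L.rep - ∑ r, KZ.of (t r).rep ∈ KZ.relations := by
      refine RFun.rel_sum Finset.univ t L fun x hx => ?_
      have n₁ := fhQ_ne_zero_of q (landen_h₁ q hq1) x hx
      have n₂ := fhQ_ne_zero_of (-q) (landen_h₂ q hq1) x hx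
      have n₃ := fhQ_ne_zero_of (-q ^ 2) (landen_h₃ q hq1) x hx
      rw [Fin.sum_univ_three]
      simp only [ht, hL, Matrix.cons_val_zero, Matrix.cons_val_one, Matrix.cons_val_two, Matrix.tail_cons,
        Matrix.head_cons, RFun.fn_apply, landenT, landenM, smulNum_num, smulNum_den, fhR_num, fhR_den,
        map_mul, map_add, MvPolynomial.aeval_C, map_one, eq_ratCast]
      field_simp
    rw [value_eq_sum_of_rel _ _ _ hrel, Fin.sum_univ_three]
    simp only [ht, Matrix.cons_val_zero, Matrix.cons_val_one, Matrix.cons_val_two, Matrix.tail_cons,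
      Matrix.head_cons, value_smulNum]
    rfl
  -- (3) the exact part descends to its faces; face values lie in W
  obtain ⟨G, hG⟩ := mem_ex0m_iff.mp hspan
  have h3 := exact_rel_faceFam E G hG
  have hEval : E.rep.value = ∑ p, (faceFam E G p).rep.value := value_eq_sum_of_rel _ _ _ h3
  have hEW : E.rep.value ∈ inSpanSub q (landen_h₁ q hq1) 1 ⊔ inSpanSub (-q) (landen_h₂ q hq1) 1 := by
    rw [hEval]
    refine Submodule.sum_mem _ fun p _ => ?_
    obtain ⟨c', hc', hden⟩ := faceFam_den E G p
    exact face_value_mem q hq1 _ p.1 c' hc' hden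
  -- (4) Landen on the values + the two-point input: a + 2c = b + 2c = 0
  have hLan := letter_landen q hq1 (landen_h₁ q hq1) (landen_h₂ q hq1) (landen_h₃ q hq1) 2
  have key : ((a + 2 * c : ℚ) : ℝ) * letter q (landen_h₁ q hq1) 2
      + ((b + 2 * c : ℚ) : ℝ) * letter (-q) (landen_h₂ q hq1) 2 = -E.rep.value := by
    have h := h0
    rw [hTval, hLv] at h
    push_cast
    linear_combination h + 2 * (c : ℝ) * hLan
  have hmem : ((a + 2 * c : ℚ) : ℝ) * letter q (landen_h₁ q hq1) 2
      + ((b + 2 * c : ℚ) : ℝ) * letter (-q) (landen_h₂ q hq1) 2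
      ∈ inSpanSub q (landen_h₁ q hq1) 1 ⊔ inSpanSub (-q) (landen_h₂ q hq1) 1 := by
    rw [key]
    exact Submodule.neg_mem _ hEW
  obtain ⟨hac, hbc⟩ := hN (a + 2 * c) (b + 2 * c) hmem
  have hE0 : E.rep.value = 0 := by
    have h := key
    rw [hac, hbc] at h
    push_cast at h
    linarith
  -- (5) the faces: a dimension-1 family of total value 0 — Baker-in-the-tree
  have h5 : ∑ p, KZ.of (faceFam E G p).rep ∈ KZ.relations :=
    familyKernel_of_le_one (k := 1) (fun _ => Set.univ) le_rfl (Fin (1 + 1) × Bool) (faceFam E G)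
      (fun _ => Set.mem_univ _) (by rw [← hEval, hE0])
  -- (6) the letter part is `−2c·[P_L/Q_L]`: a relation by the substitution move
  have ha : a = -(2 * c) := by linarith
  have hb : b = -(2 * c) := by linarith
  have h6 : KZ.of L.rep ∈ KZ.relations := by
    have e1 : KZ.of L.rep - KZ.of (smulNum (-(2 * c)) (landenR q hq1)).rep ∈ KZ.relations := by
      refine RFun.rel_of_eqOn fun x hx => ?_
      rw [fn_smulNum]
      simp only [hL, RFun.fn_apply, landenT, landenM, landenR, landenP, landenQ, ha, hb, map_mul, map_add,
        map_sub, map_neg, MvPolynomial.aeval_C, eq_ratCast]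
      push_cast
      ring
    have e : KZ.of L.rep = (KZ.of L.rep - KZ.of (smulNum (-(2 * c)) (landenR q hq1)).rep)
        + KZ.of (smulNum (-(2 * c)) (landenR q hq1)).rep := by abel
    rw [e]
    exact add_mem e1 (smul_landenR_mem_relations q hq1 _)
  -- (7) assemble
  have e : KZ.of (landenT q hq1 2 P).rep
      = (KZ.of (landenT q hq1 2 P).rep - KZ.of E.rep - KZ.of L.rep)
        + (KZ.of E.rep - ∑ p, KZ.of (faceFam E G p).rep) + ∑ p, KZ.of (faceFam E G p).rep + KZ.of L.rep := by
    abel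
  rw [e]
  exact add_mem (add_mem (add_mem h1 h3) h5) h6

end LandenClass
end LetterCriterion
end Summit.KontsevichZagierPeriods.RootDecompRationalCubeDichotomy.Rung26322.RankDescent
end
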